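import Literature.MathematicalPhysics.QuantumFieldTheory.LatticeGaugeAsymptotics
import Literature.MathematicalPhysics.QuantumFieldTheory.FiniteGaugeGroupTorus
import Literature.MathematicalPhysics.QuantumLattice.WilsonLoopsProofs
import Literature.Probability.LatticeModels.GKSInequalities
import HarnessLib

/-!
# `ℤ₂` lattice gauge theory on the torus as a ferromagnetic `±1` spin system (GKS form)

Four-dimensional (here: `d`-dimensional) `ℤ₂` lattice gauge theory is "quite simple to describe as
a model of statistical mechanics" (S. Chatterjee, *Wilson loops in Ising lattice gauge theory*,
Comm. Math. Phys. 377 (2020), §1.1): `±1` spins on the edges, probability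
`∝ exp (β ∑ₚ σ_p)` with `σ_p = σ_{e₁} σ_{e₂} σ_{e₃} σ_{e₄}` ((1.1)–(1.2)), and Wilson loop variable
`W_γ = ∏_{e ∈ γ} σ_e` ((1.3)). This file identifies the tree's measure-theoretic torus Wilson
theory for the gauge group `Multiplicative (ZMod 2)` and the representation `z2Rep`
(`ConstructiveQFTWave0`: `wilsonMeasure`, `wilsonExpectation`; periodic lifts `torusLift`,
`toTorusObservable` of `LatticeGaugeDLR`; lattice loops and `wilsonLoopObs` of `WilsonLoops`)
with a **ferromagnetic generalised Ising system** in the sense of the tree's GKS file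
(`Literature.Probability.LatticeModels.gksExpect`, Friedli–Velenik 2017 §3.8.1): spins
`SpinConfig (Edge d M)`, one coupling `Kₚ = β ≥ 0` per plaquette with interaction set `Cₚ` = the
four edges of `p` (`torusPlaqEdges`).

## Main results (everything is proved; no named fact)

* `spinCfg`, `spinCfgEquiv`: `ℤ₂` gauge configurations `≃` spin configurations on the edges,
  `spinAt e (spinCfg U) = z2Character (U e)`.
* `neg_mul_wilsonAction_z2`: `-β S(U) = -β |P| + ∑ₚ β ω_{Cₚ}` (the Wilson action of `z2Rep` is
  `∑ₚ (1 - σ_p)`), for torus side `M ≥ 2`.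
* `toTorusObservable_wilsonLoopObs_z2_eq_spinProduct`: `W_γ ∘ torusLift = σ_A`, `A` the torus
  edges of the loop, when these are distinct; `nodup_torusLoopEdgeList`: they are, for a trail
  (self-avoiding loop) of length `< M` (`abs_sub_le_length_of_mem_support`: two sites on a walk
  differ by at most its length in each coordinate, so the periodisation is injective on it).
* `wilsonExpectation_z2_eq_gksExpect`: **`⟨W_γ⟩_{Λ_M,β} = gksExpect univ (fun _ => β) torusPlaqEdges σ_A`**
  (via `wilsonExpectation_eq_gibbsAverage`: over a finite gauge group torus expectations are
  finite Gibbs averages).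
* `wilsonExpectation_z2_nonneg`: **GKS I**, `0 ≤ ⟨W_γ⟩_{Λ_M,β}` for `β ≥ 0` — the lower half of
  Chatterjee's Lemma 7.2 (`|⟨W_γ⟩| ≤ e^{-C(ℓ-ℓ₀)e^{-12β}}`) in finite volume with periodic
  boundary conditions. The upper half (`≤ (tanh 6β)^{ℓ-ℓ₀}`, GKS II freezing,
  `Literature.Probability.LatticeModels.gksExpect_spinProduct_le_prod_tanh`) is the sequel.

These are the Griffiths–Kelly–Sherman inputs for the torus-state form
`Literature.MathematicalPhysics.QuantumFieldTheory.chatterjee_z2_wilsonLoops` of Chatterjee's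
Thm. 1.1 (see `LatticeGaugeAsymptoticsCornerEdges.lean` for the relation to the printed,
free-boundary statement).

## References

* S. Chatterjee, *Wilson loops in Ising lattice gauge theory*, Comm. Math. Phys. 377 (2020)
  307–340, arXiv:1811.09770, §1.1 and Lemma 7.2. [arXiv181109770]
* S. Friedli, Y. Velenik, *Statistical Mechanics of Lattice Systems* (CUP 2017), §3.8.1
  (GKS inequalities for `ν_{Λ;K} ∝ exp (∑ K_C ω_C)`). [FriedliVelenik2017]
* E. Seiler, LNP 159 (1982), Ch. 1 (finite-volume lattice gauge theory). [SeilerLNP1982]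
-/

noncomputable section

open MeasureTheory Filter Topology SimpleGraph Finset
open Literature.Probability.LatticeModels Literature.MathematicalPhysics.QuantumLattice

namespace Literature.MathematicalPhysics.QuantumFieldTheory

/-! ### The group `ℤ₂ = Multiplicative (ZMod 2)` and its character -/

/-- An element of `ℤ₂` other than `1` is the generator. [folklore] -/
theorem z2_eq_ofAdd_one_of_ne_one {a : Multiplicative (ZMod 2)} (h : a ≠ 1) :
    a = Multiplicative.ofAdd 1 := by
  have h' : a.toAdd ≠ 0 := fun h0 => h (toAdd_eq_zero.1 h0)
  have : a.toAdd = 1 := by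
    generalize a.toAdd = z at h'
    fin_cases z
    · exact absurd rfl h'
    · rfl
  rw [← this, ofAdd_toAdd]

/-- `z2Character a = Re tr z2Rep a`. [folklore] -/
theorem z2Character_eq_trace_re (a : Multiplicative (ZMod 2)) :
    z2Character a = (z2Rep a).trace.re := by
  simp [z2Character, normalisedCharacter]

/-- `z2Character 1 = 1`. [folklore] -/
@[simp] theorem z2Character_one : z2Character 1 = 1 := by
  rw [z2Character_apply]; simp

/-- `z2Character (ofAdd 1) = -1`. [folklore] -/
@[simp] theorem z2Character_ofAdd_one : z2Character (Multiplicative.ofAdd (1 : ZMod 2)) = -1 := by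
  rw [z2Character_apply, toAdd_ofAdd]
  have : (1 : ZMod 2).val = 1 := rfl
  rw [this, pow_one]

/-- `z2Character` is multiplicative. [folklore] -/
theorem z2Character_mul (a b : Multiplicative (ZMod 2)) :
    z2Character (a * b) = z2Character a * z2Character b := by
  simp only [z2Character_apply, toAdd_mul, ZMod.val_add, ← pow_add]
  rw [← neg_one_pow_eq_pow_mod_two]

/-- `z2Character a⁻¹ = z2Character a` (`ℤ₂` has exponent `2`). [folklore] -/
theorem z2Character_inv (a : Multiplicative (ZMod 2)) : z2Character a⁻¹ = z2Character a := by
  simp only [z2Character_apply, toAdd_inv, ZMod.neg_eq_self_mod_two]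

/-- `z2Character` as a monoid homomorphism `ℤ₂ →* ℝ`. [folklore] -/
def z2CharacterHom : Multiplicative (ZMod 2) →* ℝ where
  toFun := z2Character
  map_one' := z2Character_one
  map_mul' := z2Character_mul

/-- `z2CharacterHom` is `z2Character`. [folklore] -/
@[simp] theorem z2CharacterHom_apply (a : Multiplicative (ZMod 2)) : z2CharacterHom a = z2Character a := rfl

/-- The `±1` spin of an element of `ℤ₂`. [folklore] -/
def z2Spin (a : Multiplicative (ZMod 2)) : ℤˣ := if a = 1 then 1 else -1

/-- The spin of `a` cast to `ℝ` is the character `z2Character a = (-1)^a`. [folklore] -/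
theorem cast_z2Spin (a : Multiplicative (ZMod 2)) : (((z2Spin a : ℤˣ) : ℤ) : ℝ) = z2Character a := by
  unfold z2Spin
  by_cases h : a = 1
  · subst h; simp
  · rw [if_neg h, z2_eq_ofAdd_one_of_ne_one h, z2Character_ofAdd_one]; simp

/-- `ℤ₂ ≃ {±1}`. [folklore] -/
def z2UnitEquiv : Multiplicative (ZMod 2) ≃ ℤˣ where
  toFun := z2Spin
  invFun u := if u = 1 then 1 else Multiplicative.ofAdd 1
  left_inv a := by
    by_cases h : a = 1
    · subst h; simp [z2Spin]
    · have hne : (z2Spin a) ≠ 1 := by simp [z2Spin, h]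
      simp only [if_neg hne]
      exact (z2_eq_ofAdd_one_of_ne_one h).symm
  right_inv u := by
    rcases Int.units_eq_one_or u with rfl | rfl
    · simp [z2Spin]
    · have h1 : (-1 : ℤˣ) ≠ 1 := by decide
      have h2 : (Multiplicative.ofAdd (1 : ZMod 2)) ≠ 1 := by decide
      simp [z2Spin, h1, h2]


/-! ### Torus `ℤ₂` gauge configurations as `±1` spin configurations on the edges -/

section Torus

variable {d M : ℕ}

/-- The `±1` spin configuration on the edges of the torus attached to a `ℤ₂` gauge
configuration (Chatterjee 2020 §1.1: "configurations of `±1`-valued spins assigned to edges").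
[cite: arXiv181109770, §1.1] -/
def spinCfg (U : GaugeConfig d M (Multiplicative (ZMod 2))) : SpinConfig (Edge d M) :=
  fun e => z2Spin (U e)

/-- The spin at `e` is the character of the edge variable. [folklore] -/
@[simp] theorem spinAt_spinCfg (U : GaugeConfig d M (Multiplicative (ZMod 2))) (e : Edge d M) :
    spinAt e (spinCfg U) = z2Character (U e) :=
  cast_z2Spin (U e)

/-- `U ↦ spinCfg U` is a bijection between `ℤ₂` gauge configurations and spin configurations on
the edges. [folklore] -/
def spinCfgEquiv : GaugeConfig d M (Multiplicative (ZMod 2)) ≃ SpinConfig (Edge d M) :=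
  Equiv.piCongrRight fun _ => z2UnitEquiv

/-- `spinCfgEquiv` is `spinCfg`. [folklore] -/
@[simp] theorem spinCfgEquiv_apply (U : GaugeConfig d M (Multiplicative (ZMod 2))) :
    spinCfgEquiv U = spinCfg U := rfl

/-- The four edges `(x,i), (x+eᵢ,j), (x+eⱼ,i), (x,j)` of the torus plaquette `p = (x; i < j)`
(the interaction sets `Cₚ` of the plaquette couplings; Chatterjee 2020 (1.1):
`σ_p = σ_{e₁} σ_{e₂} σ_{e₃} σ_{e₄}`). [cite: arXiv181109770, §1.1 (1.1)] -/
def torusPlaqEdges (p : Plaquette d M) : Finset (Edge d M) :=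
  {(p.1, p.2.1.1), (p.1.shift p.2.1.1, p.2.1.2), (p.1.shift p.2.1.2, p.2.1.1), (p.1, p.2.1.2)}

/-- For `ℤ₂` the plaquette variable is the product of the four edge characters
(`σ_p = σ_{e₁} σ_{e₂} σ_{e₃} σ_{e₄}`, inverses being trivial). [cite: arXiv181109770, §1.1 (1.1)] -/
theorem z2Character_plaquetteHolonomy (U : GaugeConfig d M (Multiplicative (ZMod 2)))
    (x : Site d M) (i j : Fin d) :
    z2Character (plaquetteHolonomy U x i j) =
      z2Character (U (x, i)) * z2Character (U (x.shift i, j)) * z2Character (U (x.shift j, i)) *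
        z2Character (U (x, j)) := by
  simp only [plaquetteHolonomy, z2Character_mul, z2Character_inv]

/-- On a torus of side `M ≥ 2` a site is not its own neighbour. [folklore] -/
theorem Site.shift_ne_self [NeZero M] [Fact (1 < M)] (x : Site d M) (i : Fin d) : x.shift i ≠ x := by
  intro h
  have h1 : (x.shift i) i = x i := by rw [h]
  simp [Site.shift] at h1

/-- The plaquette variable `σ_p` is the spin product over the four (distinct, `M ≥ 2`) edges of
`p`. [cite: arXiv181109770, §1.1 (1.1)] -/
theorem spinProduct_torusPlaqEdges [NeZero M] [Fact (1 < M)]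
    (U : GaugeConfig d M (Multiplicative (ZMod 2))) (p : Plaquette d M) :
    spinProduct (torusPlaqEdges p) (spinCfg U) =
      z2Character (plaquetteHolonomy U p.1 p.2.1.1 p.2.1.2) := by
  obtain ⟨x, ⟨i, j⟩, hij⟩ := p
  have hne : i ≠ j := hij.ne
  simp only [torusPlaqEdges, spinProduct, z2Character_plaquetteHolonomy]
  rw [Finset.prod_insert, Finset.prod_insert, Finset.prod_insert, Finset.prod_singleton]
  · simp only [spinAt_spinCfg]; ring
  · simp [hne]
  · simp [hne.symm, Site.shift_ne_self]
  · simp [hne, (Site.shift_ne_self x j).symm]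

/-- **The `ℤ₂` Wilson action is a ferromagnetic plaquette Hamiltonian**:
`S(U) = ∑ₚ (1 - σ_p) = |P| - ∑ₚ σ_p`, i.e. `-β S(U) = -β |P| + ∑ₚ β σ_p` with
`σ_p = ω_{Cₚ}` (Chatterjee 2020 (1.2): `H_N(σ) = -∑_p σ_p`). [cite: arXiv181109770, §1.1 (1.2)] -/
theorem neg_mul_wilsonAction_z2 [NeZero M] [Fact (1 < M)] (β : ℝ)
    (U : GaugeConfig d M (Multiplicative (ZMod 2))) :
    -β * wilsonAction z2Rep U =
      -β * Fintype.card (Plaquette d M) +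
        gksHamiltonian (univ : Finset (Plaquette d M)) (fun _ => β) torusPlaqEdges (spinCfg U) := by
  have h1 : wilsonAction z2Rep U =
      Fintype.card (Plaquette d M) - ∑ p, spinProduct (torusPlaqEdges p) (spinCfg U) := by
    simp only [wilsonAction, spinProduct_torusPlaqEdges, ← z2Character_eq_trace_re, Nat.cast_one,
      Finset.sum_sub_distrib, Finset.sum_const, Finset.card_univ, nsmul_eq_mul, mul_one]
  rw [h1, gksHamiltonian, mul_sub, Finset.mul_sum]
  simp only [neg_mul, Finset.sum_neg_distrib]
  ring

/-- The `ℤ₂` torus Wilson weight is `e^{-β|P|}` times the GKS weight of the plaquette system.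
[cite: arXiv181109770, §1.1 (1.2)] -/
theorem exp_neg_mul_wilsonAction_z2 [NeZero M] [Fact (1 < M)] (β : ℝ)
    (U : GaugeConfig d M (Multiplicative (ZMod 2))) :
    Real.exp (-β * wilsonAction z2Rep U) =
      Real.exp (-β * Fintype.card (Plaquette d M)) *
        gksWeight (univ : Finset (Plaquette d M)) (fun _ => β) torusPlaqEdges (spinCfg U) := by
  rw [neg_mul_wilsonAction_z2, Real.exp_add, gksWeight]

/-! ### The Wilson loop variable through the periodic lift is a spin product over the loop's edges -/

/-- The torus edges under the darts of a lattice walk, read through the periodisation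
`torusEdge M` (with multiplicity, as a list). [folklore] -/
def torusLoopEdgeList (M : ℕ) {x y : Literature.Probability.LatticeModels.Site d} (w : (zdGraph d).Walk x y) :
    List (Edge d M) :=
  w.darts.map fun e => torusEdge M (dartStep e).1

/-- The set of torus edges of a lattice loop read through the periodisation (for a self-avoiding
loop shorter than the torus these are `ℓ` distinct edges, `nodup_torusLoopEdgeList`).
[folklore] -/
def torusLoopEdges (M : ℕ) {x y : Literature.Probability.LatticeModels.Site d} (w : (zdGraph d).Walk x y) :
    Finset (Edge d M) :=
  (torusLoopEdgeList M w).toFinset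

/-- For `ℤ₂`, the character of a dart holonomy of the periodic lift is the spin of the torus edge
under the dart (the inverse on a backward dart is invisible: `σ⁻¹ = σ`). [folklore] -/
theorem z2Character_dartHolonomy_torusLift (M : ℕ) (U : GaugeConfig d M (Multiplicative (ZMod 2)))
    (e : (zdGraph d).Dart) :
    z2Character (dartHolonomy (torusLift M U) e) = spinAt (torusEdge M (dartStep e).1) (spinCfg U) := by
  rw [spinAt_spinCfg, dartHolonomy]
  split_ifs
  · rfl
  · rw [z2Character_inv]; rfl

/-- **The `ℤ₂` Wilson loop variable is a spin product**: through the periodic lift,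
`W_γ(U) = ∏_{e ∈ γ} σ_e` (Chatterjee 2020 (1.3)), the product running over the darts of the walk.
[cite: arXiv181109770, §1.1 (1.3)] -/
theorem toTorusObservable_wilsonLoopObs_z2 (M : ℕ) {x : Literature.Probability.LatticeModels.Site d}
    (w : (zdGraph d).Walk x x) (U : GaugeConfig d M (Multiplicative (ZMod 2))) :
    toTorusObservable M (wilsonLoopObs z2Character w) U =
      ((torusLoopEdgeList M w).map fun a => spinAt a (spinCfg U)).prod := by
  rw [toTorusObservable_apply, wilsonLoopObs, walkHolonomy, ← z2CharacterHom_apply, map_list_prod,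
    List.map_map, torusLoopEdgeList, List.map_map]
  congr 1
  refine List.map_congr_left fun e _ => ?_
  simp only [Function.comp_apply, z2CharacterHom_apply, z2Character_dartHolonomy_torusLift]

/-- For a walk whose torus edges are distinct, `W_γ = σ_A` with `A = torusLoopEdges M w`.
[cite: arXiv181109770, §1.1 (1.3)] -/
theorem toTorusObservable_wilsonLoopObs_z2_eq_spinProduct (M : ℕ)
    {x : Literature.Probability.LatticeModels.Site d} (w : (zdGraph d).Walk x x)
    (hnd : (torusLoopEdgeList M w).Nodup) (U : GaugeConfig d M (Multiplicative (ZMod 2))) :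
    toTorusObservable M (wilsonLoopObs z2Character w) U = spinProduct (torusLoopEdges M w) (spinCfg U) := by
  rw [toTorusObservable_wilsonLoopObs_z2, spinProduct, torusLoopEdges, List.prod_toFinset _ hnd]

/-! ### Self-avoiding loops shorter than the torus have distinct torus edges -/

/-- The unoriented edge of a dart of `ℤ^d` is recovered from the positively oriented edge under it:
`{x, y} = {z, z + eᵢ}` for `dartStep e = ((z, i), ±)`. [folklore] -/
theorem Dart.edge_eq_of_dartStep (e : (zdGraph d).Dart) :
    e.edge = s((dartStep e).1.1, (dartStep e).1.1 + Pi.single (dartStep e).1.2 1) := by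
  unfold dartStep
  split_ifs with h
  · change s(e.fst, e.snd) = _
    rw [← h]
  · have h' : e.fst = e.snd + Pi.single (dartDir e) 1 := (dartDir_spec e).resolve_left h
    change s(e.fst, e.snd) = _
    rw [← h', Sym2.eq_swap]

/-- The unoriented edge `{z, z + eᵢ}` of the positively oriented edge `(z, i)`. [folklore] -/
def ZdEdge.toSym2 (zi : ZdEdge d) : Sym2 (Literature.Probability.LatticeModels.Site d) :=
  s(zi.1, zi.1 + Pi.single zi.2 1)

/-- Along a trail the positively oriented edges under the darts are pairwise distinct. [folklore] -/
theorem nodup_map_dartStep_of_isTrail {x y : Literature.Probability.LatticeModels.Site d}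
    {w : (zdGraph d).Walk x y} (hw : w.IsTrail) : (w.darts.map fun e => (dartStep e).1).Nodup := by
  have h : ((w.darts.map fun e => (dartStep e).1).map ZdEdge.toSym2) = w.edges := by
    rw [List.map_map, SimpleGraph.Walk.edges]
    exact List.map_congr_left fun e _ => (Dart.edge_eq_of_dartStep e).symm
  exact List.Nodup.of_map ZdEdge.toSym2 (h ▸ hw.edges_nodup)

/-- Adjacent lattice sites differ by at most `1` in every coordinate. [folklore] -/
theorem abs_sub_le_one_of_adj {u v : Literature.Probability.LatticeModels.Site d} (h : (zdGraph d).Adj u v)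
    (k : Fin d) : |u k - v k| ≤ 1 := by
  obtain ⟨i, hi | hi⟩ := (zdGraph_adj_iff u v).1 h
  · rw [hi]
    by_cases hk : k = i
    · subst hk; simp
    · simp [Pi.single_eq_of_ne hk]
  · rw [hi]
    by_cases hk : k = i
    · subst hk; simp
    · simp [Pi.single_eq_of_ne hk]

/-- Two sites on a lattice walk differ by at most the length of the walk in every coordinate.
[folklore] -/
theorem abs_sub_le_length_of_mem_support {u v : Literature.Probability.LatticeModels.Site d}
    (w : (zdGraph d).Walk u v) :
    ∀ {y z : Literature.Probability.LatticeModels.Site d}, y ∈ w.support → z ∈ w.support →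
      ∀ k : Fin d, |y k - z k| ≤ w.length := by
  induction w with
  | nil =>
    intro y z hy hz k
    rw [SimpleGraph.Walk.support_nil, List.mem_singleton] at hy hz
    subst hy; subst hz; simp
  | @cons a b c hab p ih =>
    intro y z hy hz k
    rw [SimpleGraph.Walk.support_cons, List.mem_cons] at hy hz
    rw [SimpleGraph.Walk.length_cons, Nat.cast_add, Nat.cast_one]
    have hb : b ∈ p.support := p.start_mem_support
    have hlen : (0 : ℤ) ≤ p.length := Nat.cast_nonneg _
    rcases hy with rfl | hy <;> rcases hz with rfl | hz
    · simp only [sub_self, abs_zero]; linarith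
    · calc |y k - z k| ≤ |y k - b k| + |b k - z k| := abs_sub_le _ _ _
        _ ≤ 1 + p.length := add_le_add (abs_sub_le_one_of_adj hab k) (ih hb hz k)
        _ = p.length + 1 := add_comm _ _
    · calc |y k - z k| ≤ |y k - b k| + |b k - z k| := abs_sub_le _ _ _
        _ ≤ p.length + 1 := add_le_add (ih hy hb k) (by
            rw [abs_sub_comm]; exact abs_sub_le_one_of_adj hab k)
    · exact (ih hy hz k).trans (by linarith)

/-- The periodisation `torusEdge M` is injective on the edges under the darts of a walk shorter
than the torus. [folklore] -/
theorem torusEdge_injOn_darts {M : ℕ} {x y : Literature.Probability.LatticeModels.Site d}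
    (w : (zdGraph d).Walk x y) (hM : w.length < M) {e e' : (zdGraph d).Dart} (he : e ∈ w.darts)
    (he' : e' ∈ w.darts) (h : torusEdge M (dartStep e).1 = torusEdge M (dartStep e').1) :
    (dartStep e).1 = (dartStep e').1 := by
  -- the base points of the two edges are support vertices, congruent mod `M`, hence equal
  have hbase : ∀ f : (zdGraph d).Dart, f ∈ w.darts → (dartStep f).1.1 ∈ w.support := by
    intro f hf
    unfold dartStep
    split_ifs
    · exact w.dart_fst_mem_support_of_mem_darts hf
    · exact w.dart_snd_mem_support_of_mem_darts hf
  obtain ⟨h1, h2⟩ := Prod.mk.inj h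
  refine Prod.ext ?_ h2
  funext k
  have hk : ((dartStep e).1.1 k : ZMod M) = ((dartStep e').1.1 k : ZMod M) := by
    have := congrFun h1 k
    simpa [Torus.proj] using this
  rw [ZMod.intCast_eq_intCast_iff_dvd_sub] at hk
  have habs : |(dartStep e').1.1 k - (dartStep e).1.1 k| < M :=
    (abs_sub_le_length_of_mem_support w (hbase e' he') (hbase e he) k).trans_lt (by exact_mod_cast hM)
  have h0 := Int.eq_zero_of_abs_lt_dvd hk habs
  linarith

/-- **A self-avoiding loop (trail) shorter than the torus has `ℓ` distinct torus edges.** [folklore] -/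
theorem nodup_torusLoopEdgeList {M : ℕ} {x y : Literature.Probability.LatticeModels.Site d}
    {w : (zdGraph d).Walk x y} (hw : w.IsTrail) (hM : w.length < M) : (torusLoopEdgeList M w).Nodup := by
  have h := nodup_map_dartStep_of_isTrail hw
  rw [show torusLoopEdgeList M w = (w.darts.map fun e => (dartStep e).1).map (torusEdge M) from by
    rw [torusLoopEdgeList, List.map_map]; rfl]
  refine h.map_on fun a ha b hb hab => ?_
  obtain ⟨e, he, rfl⟩ := List.mem_map.1 ha
  obtain ⟨e', he', rfl⟩ := List.mem_map.1 hb
  exact torusEdge_injOn_darts w hM he he' hab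

/-- The number of torus edges of a self-avoiding loop shorter than the torus is its length. [folklore] -/
theorem card_torusLoopEdges {M : ℕ} {x y : Literature.Probability.LatticeModels.Site d}
    {w : (zdGraph d).Walk x y} (hw : w.IsTrail) (hM : w.length < M) :
    (torusLoopEdges M w).card = w.length := by
  rw [torusLoopEdges, List.toFinset_card_of_nodup (nodup_torusLoopEdgeList hw hM), torusLoopEdgeList,
    List.length_map, SimpleGraph.Walk.length_darts]

/-! ### The torus Wilson loop expectation is a GKS expectation -/

/-- **`ℤ₂` torus Wilson loop expectations are ferromagnetic spin-system expectations**: for a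
self-avoiding loop `γ` (a trail) shorter than the torus side `M ≥ 2`,
`⟨W_γ⟩_{Λ_M,β} = ⟨σ_A⟩_{ν}`, where `ν ∝ exp (∑ₚ β ω_{Cₚ})` is the `±1` system on the torus edges
with one coupling `β` per plaquette (`Cₚ` its four edges) and `A` the set of torus edges of `γ`
(Chatterjee 2020 §1.1, (1.1)–(1.3); the uniform product Haar weights cancel,
`wilsonExpectation_eq_gibbsAverage`). [cite: arXiv181109770, §1.1] -/
theorem wilsonExpectation_z2_eq_gksExpect {M : ℕ} [NeZero M] [Fact (1 < M)] (β : ℝ)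
    {x : Literature.Probability.LatticeModels.Site d} {w : (zdGraph d).Walk x x} (hw : w.IsTrail)
    (hM : w.length < M) :
    wilsonExpectation (L := M) z2Rep β (toTorusObservable M (wilsonLoopObs z2Character w)) =
      gksExpect (univ : Finset (Plaquette d M)) (fun _ => β) torusPlaqEdges
        (spinProduct (torusLoopEdges M w)) := by
  rw [wilsonExpectation_eq_gibbsAverage z2Rep continuous_of_discreteTopology β]
  simp only [toTorusObservable_wilsonLoopObs_z2_eq_spinProduct M w (nodup_torusLoopEdgeList hw hM),
    exp_neg_mul_wilsonAction_z2]
  rw [gksExpect, gksSum, gksSum]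
  rw [← spinCfgEquiv.sum_comp (fun ω => spinProduct (torusLoopEdges M w) ω *
      gksWeight univ (fun _ => β) torusPlaqEdges ω),
    ← spinCfgEquiv.sum_comp (fun ω => 1 * gksWeight univ (fun _ => β) torusPlaqEdges ω)]
  simp only [spinCfgEquiv_apply, one_mul, mul_left_comm _ (Real.exp _), ← Finset.mul_sum]
  rw [mul_div_mul_left _ _ (Real.exp_pos _).ne']

/-- **Griffiths' first inequality for `ℤ₂` Wilson loops**: `0 ≤ ⟨W_γ⟩_{Λ_M,β}` for `β ≥ 0`, every
torus of side `M ≥ 2` and every self-avoiding loop shorter than `M` (GKS I for the ferromagnetic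
plaquette system; this is the lower half `⟨W_γ⟩ ≥ -e^{-C(ℓ-ℓ₀)e^{-12β}}` of Chatterjee 2020,
Lemma 7.2, in finite volume with periodic boundary conditions). [cite: arXiv181109770, Lemma 7.2] -/
theorem wilsonExpectation_z2_nonneg {M : ℕ} [NeZero M] [Fact (1 < M)] {β : ℝ} (hβ : 0 ≤ β)
    {x : Literature.Probability.LatticeModels.Site d} {w : (zdGraph d).Walk x x} (hw : w.IsTrail)
    (hM : w.length < M) :
    0 ≤ wilsonExpectation (L := M) z2Rep β (toTorusObservable M (wilsonLoopObs z2Character w)) := by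
  rw [wilsonExpectation_z2_eq_gksExpect β hw hM]
  exact gksExpect_spinProduct_nonneg _ _ _ (fun _ _ => hβ) _

end Torus

end Literature.MathematicalPhysics.QuantumFieldTheory
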